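import Mathlib
import Summits.Ventures.PercRepro2.SwOutCrossJunctionMark
import Summits.Ventures.PercRepro2.SwOutCrossJunctionExample

/-!
# Moving the mark of a cross junction, and the mark anywhere on an instance (blind cell
PercRepro2, night-4 g27, 2026-08-28; proofs/NIGHT4-G27.md §6)

A cross junction with the mark anywhere whose mark has an outside edge or no edge keeps being one
when the mark is moved to ANY vertex (`CrossJunctionM.moveMark`: the old mark joins the ordinary
vertices of `hout`; a new dropped mark's outside edge comes from `hout` + `hup`).  On g24's
`crossEx` (`l = 0`, `h = 1`, the old mark `2` with its edge to `l`, the junction `3`, the dropped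
vertices `4`, `5` with the cross edge, the u-arm `6`) the mark may therefore be ANY vertex:
**`sw_crossEx_mark : ∀ o, Sw crossEx 0 1 o`** — seven marks, one theorem (the mark at `2`, `6`,
`0` and `1` by the landed `CrossJunction` theorems, which never needed `o ≠ h`; at the junction
`3` by `sw_of_crossJunctionU`; at `4`, `5` by this seat's `sw_of_crossJunctionQ_any`).
-/

namespace Summit.Ventures.PercRepro2

namespace CrossArm

open Hull LocRows

section Move

variable {V : Type*} {E : Type*} {ends : E → Sym2 V} {X : Type*} {U : Set V} {h u o : V}
  {p : X → V} {G : SimpleGraph X}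

/-- **Moving the mark**: a cross junction with the mark anywhere, whose mark has an outside edge
or no edge, is one with the mark at any vertex `o'`. -/
theorem CrossJunctionM.moveMark (hj : CrossJunctionM ends U h u p G o) (o' : V)
    (ho : (∃ e y, ends e = s(o, y) ∧ y ∉ U) ∨ ∀ e, o ∉ ends e) :
    CrossJunctionM ends U h u p G o' where
  hne_hu := hj.hne_hu
  hne_hp := hj.hne_hp
  hne_up := hj.hne_up
  p_inj := hj.p_inj
  hhU := hj.hhU
  huU := hj.huU
  hpU := hj.hpU
  hloop_h := hj.hloop_h
  hloop_u := hj.hloop_u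
  hnadj := hj.hnadj
  hnadj_p := hj.hnadj_p
  hup := hj.hup
  hcross := hj.hcross
  hcross_adj := hj.hcross_adj
  hcross_simple := hj.hcross_simple
  hu_adj_h := hj.hu_adj_h
  hp_in := hj.hp_in
  hout := fun x hx hxh _ hxu => by
    by_cases hxo : x = o
    · subst hxo
      exact ho
    · exact hj.hout x hx hxh hxo hxu
  hext_o := fun i hi => by
    by_cases hoi : o = p i
    · exact hj.hext_o i hoi
    · rcases hj.hout (p i) (hj.hpU i) (hj.hne_hp i).symm (fun h' => hoi h'.symm)
        (hj.hne_up i).symm with ⟨e, y, hey, hyU⟩ | h'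
      · exact ⟨e, y, hey, hyU, fun h' => hyU (h' ▸ hj.huU), fun j h' => hyU (h' ▸ hj.hpU j)⟩
      · exfalso
        obtain ⟨e, he⟩ := hj.hup i
        exact h' e (by rw [he]; exact Sym2.mem_mk_right _ _)

end Move

section Example

open scoped Classical

/-- `crossEx` is a cross junction with the mark at ANY vertex (the old mark `2` has its edge to
`l = 0`). -/
theorem crossExM_junction (o : Fin 7) :
    CrossJunctionM crossEx ({0}ᶜ) 1 3 crossExP (⊤ : SimpleGraph (Fin 2)) o :=
  crossEx_junction.toM.moveMark o (Or.inl ⟨8, 0, rfl, by simp⟩)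

/-- **Row (SW) on `crossEx` with the mark at any vertex.** -/
theorem sw_crossEx_mark (o : Fin 7) : Sw crossEx 0 1 o :=
  sw_of_crossJunctionM (by decide) (crossExM_junction o)

end Example

end CrossArm

end Summit.Ventures.PercRepro2
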